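import Summits.Ventures.CertifiedArithmetic.LowPrec.DoubleRoundingGapBelow
import Summits.Ventures.CertifiedArithmetic.LowPrec.OptTreePolySigned

/-!
# Double rounding at a general midpoint — the mirror case and the tie of the wide format

HONEST FRAMING: certified error envelopes and provably optimal rounding/accumulation schemes for
low-precision formats under stated cost models; every table by two implementations; no hardware
or vendor claims.

`DoubleRoundingProductStrip.lean` treats `x = μ + δ` ABOVE the midpoint `μ = (2t+1)·2^k` quanta
of two consecutive values `t·2^(k+1) < (t+1)·2^(k+1)` of the normal range of `φ` with `t` EVEN
(the tie in `φ` goes down, the truth is up).  This file adds, for EVERY pair of format records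
`φ ⊆ ψ` (`quantum ψ ∣ quantum φ`, range of `φ` inside `ψ`, `P_φ < P_ψ`):

* the MIRROR case `x = μ - δ` with `t` ODD (the tie in `φ` goes UP to the even neighbour
  `(t+1)·2^(k+1)` — `toRat_roundNE_gmid_odd` of `OptTreePolySigned.lean` —, the truth is down
  — `DoubleRoundingGapBelow.toRat_roundNE_below_gmid`): `toRat_roundNE_wide_gmid_below`
  (`fl_ψ (μ - δ) = μ` when `2δ` is below the spacing of `ψ` at `μ`), hence
  `roundNE_roundNE_ne_gmid_below` — square roots slip this way (`DoubleRoundingSqrtStrip.lean`: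
  `√(1 - 2^-P)` lies just below the midpoint `1 - 2^(-P-1)`);
* the TIE of the wide format: when `2δ` EQUALS the spacing of `ψ` at `μ` and `m_φ + 2 ≤ m_ψ`,
  `fl_ψ (μ + δ)` is still `μ` — a midpoint of `φ` is an EVEN datum of `ψ`
  ([BoldoMelquiond2008] Thm 3) while `μ + 2δ` is odd —, `toRat_roundNE_wide_gmid_tie`, hence
  `roundNE_roundNE_ne_gmid_tie`: the product strip fails up to `P_ψ = 2P_φ - 1` included
  (`DoubleRoundingStripLaws.lean`: for `P ≥ 5` the square of `3·2^(P-2) - 1` is ONE unit above a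
  midpoint, half the spacing of a format with `2P - 1` digits).

References: [MartinDorelMelquiondMuller2013] Property 2.1 (a slip forces the intermediate onto
a midpoint; these lemmas are the converse construction at a prescribed midpoint);
[BoldoMelquiond2008] Thm 3, §III.A (parity along the grid); [Roux2014] Remarks 26 and 30
(optimality of `2p + 2` for `√` and of `2p` for `÷`, by one witness each at `p = 4`);
[Figueroa1995] §3.
-/

namespace Summit.Ventures.CertifiedArithmetic

open Literature.ComputerArithmetic.FloatingPoint
open Literature.ComputerArithmetic.FloatingPoint.Format
open Literature.ComputerArithmetic.FloatingPoint.MiniFloat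

/-! ## §1 The mirror case: `t` odd, `x` below the midpoint -/

/-- THE INTERMEDIATE ROUNDING LANDS ON THE MIDPOINT, FROM BELOW: under the hypotheses of
`toRat_roundNE_wide_gmid` (range of `φ` inside `ψ`, `P_φ < P_ψ`, the spacing of `ψ` at `μ` at
least `2^(P_φ+k+d-P_ψ) · 2 · quantum ψ`), `fl_ψ (μ - δ) = μ` as soon as `2δ` is below that
spacing: the value of `ψ` next below `μ` is a full spacing away (`le_sub_pow_of_lt`). -/
theorem toRat_roundNE_wide_gmid_below {φ ψ : Format} (hq : ψ.qexp ≤ φ.qexp)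
    (hM : φ.maxScaled * 2 ^ (φ.qexp - ψ.qexp).toNat ≤ ψ.maxScaled)
    (hP : φ.manBits < ψ.manBits) {t k : ℕ} (htlo : 2 ^ φ.manBits ≤ t)
    (hthi : t < 2 ^ (φ.manBits + 1)) (hu : (t + 1) * 2 ^ (k + 1) ≤ φ.maxScaled)
    (hk' : ψ.manBits ≤ φ.manBits + k + (φ.qexp - ψ.qexp).toNat) {δ : ℚ} (hδ0 : 0 < δ)
    (hδψ : 2 * δ
      < 2 ^ (φ.manBits + k + (φ.qexp - ψ.qexp).toNat + 1 - ψ.manBits) * ψ.quantum) :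
    (roundNE ψ ((((2 * t + 1) * 2 ^ k : ℕ) : ℚ) * φ.quantum - δ)).toRat
      = (((2 * t + 1) * 2 ^ k : ℕ) : ℚ) * φ.quantum := by
  have hqφ := φ.quantum_pos
  have hqψ := ψ.quantum_pos
  set d := (φ.qexp - ψ.qexp).toNat with hd
  set n : ℕ := (2 * t + 1) * 2 ^ k with hn
  have hnle : n ≤ 2 ^ (ψ.manBits + 1 + k) := by
    have h2 : 2 * t + 1 ≤ 2 ^ (φ.manBits + 2) := by
      rw [show φ.manBits + 2 = (φ.manBits + 1) + 1 by ring, pow_succ]; omega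
    have h3 : 2 ^ (φ.manBits + 2) ≤ 2 ^ (ψ.manBits + 1) :=
      Nat.pow_le_pow_right (by norm_num) (by omega)
    calc n = (2 * t + 1) * 2 ^ k := hn
      _ ≤ 2 ^ (ψ.manBits + 1) * 2 ^ k := Nat.mul_le_mul_right _ (le_trans h2 h3)
      _ = 2 ^ (ψ.manBits + 1 + k) := by rw [← pow_add]
  have hnmax : n ≤ φ.maxScaled := by
    refine le_trans ?_ hu
    rw [hn, pow_succ]; nlinarith
  obtain ⟨zμ, hzμ⟩ := exists_toRat_eq_natMul_of_dvd hq hM (g := k) (n := n)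
    ⟨2 * t + 1, by rw [hn]; ring⟩ hnle hnmax
  have hquant : φ.quantum = 2 ^ d * ψ.quantum := quantum_eq_two_pow_mul hq
  have hzμ' : zμ.toRat = ((n * 2 ^ d : ℕ) : ℚ) * ψ.quantum := by
    rw [hzμ, hquant]; push_cast; ring
  have hz0 : 0 ≤ zμ.toRat := by rw [hzμ]; positivity
  have hS : zμ.scaledMag = n * 2 ^ d := scaledMag_eq_of_toRat_eq hzμ'
  obtain ⟨r, hr⟩ := Nat.exists_eq_add_of_le hk'
  have h5 : 2 ^ (ψ.manBits + 1 + r) = 2 ^ (φ.manBits + 1) * 2 ^ k * 2 ^ d := by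
    rw [← pow_add, ← pow_add]; congr 1; omega
  have hlow : 2 ^ (ψ.manBits + 1 + r) + 2 ^ (k + d) ≤ n * 2 ^ d := by
    rw [h5, hn, pow_succ, pow_add]; nlinarith [Nat.mul_le_mul_right (2 ^ k * 2 ^ d) htlo]
  have he : r + 1 ≤ zμ.expCode - 1 := by
    apply succ_le_ulpExp_of_le_scaledMag (k := r)
    rw [hS]; exact le_trans (Nat.le_add_right _ _) hlow
  have hexp : φ.manBits + k + d + 1 - ψ.manBits = r + 1 := by omega
  rw [hexp] at hδψ
  have hulp : (2 : ℚ) ^ (r + 1) ≤ 2 ^ (zμ.expCode - 1) := pow_le_pow_right₀ (by norm_num) he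
  -- the gap below `μ` in `ψ`: `2^(r+1) ∣ n 2^d` since `r + 1 ≤ k + d`
  have hrk : r + 1 ≤ k + d := by omega
  have hdvd : 2 ^ (r + 1) ∣ n * 2 ^ d := by
    obtain ⟨c, hc⟩ := Nat.exists_eq_add_of_le hrk
    exact ⟨(2 * t + 1) * 2 ^ c, by rw [hn, mul_assoc, ← pow_add, hc, pow_add]; ring⟩
  have hlo : 2 ^ (ψ.manBits + (r + 1)) + 2 ^ (r + 1) ≤ n * 2 ^ d := by
    have h6 : 2 ^ (r + 1) ≤ 2 ^ (k + d) := Nat.pow_le_pow_right (by norm_num) hrk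
    rw [show ψ.manBits + (r + 1) = ψ.manBits + 1 + r by ring]; omega
  have key : (roundNE ψ ((n : ℚ) * φ.quantum - δ)).toRat = zμ.toRat := by
    apply toRat_roundNE_eq_of_forall_lt ⟨zμ, rfl⟩
    intro y hy
    rw [hzμ, show (n : ℚ) * φ.quantum - δ - (n : ℚ) * φ.quantum = -δ by ring, abs_neg,
      abs_of_pos hδ0]
    rcases lt_or_gt_of_ne hy with h | h
    · -- `y` below `μ`: at least one spacing of `ψ` away
      have hgap := le_sub_pow_of_lt hdvd hlo y (by rw [← hzμ']; exact h)
      have hcast : ((n * 2 ^ d - 2 ^ (r + 1) : ℕ) : ℚ) * ψ.quantum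
          = (n : ℚ) * φ.quantum - 2 ^ (r + 1) * ψ.quantum := by
        rw [Nat.cast_sub (le_trans (Nat.le_add_left _ _) hlo), hquant]; push_cast; ring
      rw [hcast] at hgap
      rw [hzμ] at h
      rw [abs_of_pos (by linarith)]
      linarith
    · -- `y` above `μ`
      have h1 := add_ulp_le_of_lt (y := y) hz0 h
      rw [hzμ] at h1 h
      have h6 : (2 : ℚ) ^ (r + 1) * ψ.quantum ≤ 2 ^ (zμ.expCode - 1) * ψ.quantum :=
        mul_le_mul_of_nonneg_right hulp hqψ.le
      rw [abs_of_nonpos (by linarith)]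
      linarith
  rw [key, hzμ]

/-- DOUBLE ROUNDING FAILS BELOW A GENERAL MIDPOINT — for every pair of format records: under
the hypotheses of `toRat_roundNE_wide_gmid_below` with `t` ODD and `P_φ ≥ 2`,
`fl_φ (fl_ψ x) = (t+1)·2^(k+1) ≠ t·2^(k+1) = fl_φ x` (quanta) at
`x = (2t+1)·2^k · quantum φ - δ`. [cite: MartinDorelMelquiondMuller2013, Property 2.1] -/
theorem roundNE_roundNE_ne_gmid_below {φ ψ : Format} (hq : ψ.qexp ≤ φ.qexp)
    (hM : φ.maxScaled * 2 ^ (φ.qexp - ψ.qexp).toNat ≤ ψ.maxScaled) (h1 : 1 ≤ φ.manBits)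
    (hP : φ.manBits < ψ.manBits) {t k : ℕ} (ht : Odd t) (htlo : 2 ^ φ.manBits ≤ t)
    (hthi : t < 2 ^ (φ.manBits + 1)) (hu : (t + 1) * 2 ^ (k + 1) ≤ φ.maxScaled)
    (hk' : ψ.manBits ≤ φ.manBits + k + (φ.qexp - ψ.qexp).toNat) {δ : ℚ} (hδ0 : 0 < δ)
    (hδψ : 2 * δ
      < 2 ^ (φ.manBits + k + (φ.qexp - ψ.qexp).toNat + 1 - ψ.manBits) * ψ.quantum) :
    (roundNE φ (roundNE ψ ((((2 * t + 1) * 2 ^ k : ℕ) : ℚ) * φ.quantum - δ)).toRat).toRat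
      ≠ (roundNE φ ((((2 * t + 1) * 2 ^ k : ℕ) : ℚ) * φ.quantum - δ)).toRat := by
  have hqφ := φ.quantum_pos
  have hqψ := ψ.quantum_pos
  have hδ : δ < 2 ^ k * φ.quantum := by
    have hquant : φ.quantum = 2 ^ (φ.qexp - ψ.qexp).toNat * ψ.quantum :=
      quantum_eq_two_pow_mul hq
    have h2 : (2 : ℚ) ^ (φ.manBits + k + (φ.qexp - ψ.qexp).toNat + 1 - ψ.manBits)
        ≤ 2 ^ (k + (φ.qexp - ψ.qexp).toNat) := pow_le_pow_right₀ (by norm_num) (by omega)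
    have h3 : (2 : ℚ) ^ (k + (φ.qexp - ψ.qexp).toNat) * ψ.quantum = 2 ^ k * φ.quantum := by
      rw [hquant, pow_add]; ring
    have h4 := mul_le_mul_of_nonneg_right h2 hqψ.le
    rw [h3] at h4
    linarith
  rw [toRat_roundNE_wide_gmid_below hq hM hP htlo hthi hu hk' hδ0 hδψ,
    toRat_roundNE_gmid_odd h1 ht htlo hthi hu, toRat_roundNE_below_gmid htlo hthi hu hδ0 hδ]
  intro h
  have h' := mul_right_cancel₀ hqφ.ne' h
  have h'' : (t + 1) * 2 ^ (k + 1) = t * 2 ^ (k + 1) := by exact_mod_cast h'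
  have h3 := Nat.eq_of_mul_eq_mul_right (by positivity) h''
  omega

/-! ## §2 The tie of the wide format -/

/-- AT A TIE OF THE WIDE FORMAT THE MIDPOINT WINS: under the range hypotheses of
`toRat_roundNE_wide_gmid` with `m_φ + 2 ≤ m_ψ`, if `2δ` EQUALS
`2^(P_φ+k+d-P_ψ) · 2 · quantum ψ` (the spacing of `ψ` at `μ`), then `fl_ψ (μ + δ) = μ`:
the two candidates are `μ` and `μ + 2δ`;
`μ = (2t+1)·2^(k+d)` quanta of `ψ` is a multiple of `2^(r+2)`, twice its ulp `2^(r+1)`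
(`r + 2 ≤ k + d` is `m_φ + 2 ≤ m_ψ`), so `μ` is EVEN in `ψ` and `μ + 2^(r+1)` is odd.
[cite: BoldoMelquiond2008, Thm 3] -/
theorem toRat_roundNE_wide_gmid_tie {φ ψ : Format} (hq : ψ.qexp ≤ φ.qexp)
    (hM : φ.maxScaled * 2 ^ (φ.qexp - ψ.qexp).toNat ≤ ψ.maxScaled) (h1ψ : 1 ≤ ψ.manBits)
    (hP2 : φ.manBits + 2 ≤ ψ.manBits) {t k : ℕ} (htlo : 2 ^ φ.manBits ≤ t)
    (hthi : t < 2 ^ (φ.manBits + 1)) (hu : (t + 1) * 2 ^ (k + 1) ≤ φ.maxScaled)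
    (hk' : ψ.manBits ≤ φ.manBits + k + (φ.qexp - ψ.qexp).toNat) {δ : ℚ}
    (hδψ : 2 * δ
      = 2 ^ (φ.manBits + k + (φ.qexp - ψ.qexp).toNat + 1 - ψ.manBits) * ψ.quantum) :
    (roundNE ψ ((((2 * t + 1) * 2 ^ k : ℕ) : ℚ) * φ.quantum + δ)).toRat
      = (((2 * t + 1) * 2 ^ k : ℕ) : ℚ) * φ.quantum := by
  have hqφ := φ.quantum_pos
  have hqψ := ψ.quantum_pos
  set d := (φ.qexp - ψ.qexp).toNat with hd
  set n : ℕ := (2 * t + 1) * 2 ^ k with hn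
  have hnle : n ≤ 2 ^ (ψ.manBits + 1 + k) := by
    have h2 : 2 * t + 1 ≤ 2 ^ (φ.manBits + 2) := by
      rw [show φ.manBits + 2 = (φ.manBits + 1) + 1 by ring, pow_succ]; omega
    have h3 : 2 ^ (φ.manBits + 2) ≤ 2 ^ (ψ.manBits + 1) :=
      Nat.pow_le_pow_right (by norm_num) (by omega)
    calc n = (2 * t + 1) * 2 ^ k := hn
      _ ≤ 2 ^ (ψ.manBits + 1) * 2 ^ k := Nat.mul_le_mul_right _ (le_trans h2 h3)
      _ = 2 ^ (ψ.manBits + 1 + k) := by rw [← pow_add]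
  have hn2 : n + 2 ^ k ≤ (t + 1) * 2 ^ (k + 1) := by rw [hn, pow_succ]; nlinarith
  have hnmax : n ≤ φ.maxScaled := le_trans (Nat.le_add_right _ _) (le_trans hn2 hu)
  obtain ⟨zμ, hzμ⟩ := exists_toRat_eq_natMul_of_dvd hq hM (g := k) (n := n)
    ⟨2 * t + 1, by rw [hn]; ring⟩ hnle hnmax
  have hquant : φ.quantum = 2 ^ d * ψ.quantum := quantum_eq_two_pow_mul hq
  have hzμ' : zμ.toRat = ((n * 2 ^ d : ℕ) : ℚ) * ψ.quantum := by
    rw [hzμ, hquant]; push_cast; ring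
  have hz0 : 0 ≤ zμ.toRat := by rw [hzμ]; positivity
  have hS : zμ.scaledMag = n * 2 ^ d := scaledMag_eq_of_toRat_eq hzμ'
  obtain ⟨r, hr⟩ := Nat.exists_eq_add_of_le hk'
  have h5 : 2 ^ (ψ.manBits + 1 + r) = 2 ^ (φ.manBits + 1) * 2 ^ k * 2 ^ d := by
    rw [← pow_add, ← pow_add]; congr 1; omega
  have hlow : 2 ^ (ψ.manBits + 1 + r) ≤ n * 2 ^ d := by
    rw [h5, hn]
    exact Nat.mul_le_mul_right _ (Nat.mul_le_mul_right _ (by rw [pow_succ]; omega))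
  have he : r + 1 ≤ zμ.expCode - 1 := by
    apply succ_le_ulpExp_of_le_scaledMag (k := r); rw [hS]; exact hlow
  have hexp : φ.manBits + k + d + 1 - ψ.manBits = r + 1 := by omega
  rw [hexp] at hδψ
  have hδ0 : 0 < δ := by
    have : (0 : ℚ) < 2 ^ (r + 1) * ψ.quantum := by positivity
    linarith
  have hulp : (2 : ℚ) ^ (r + 1) ≤ 2 ^ (zμ.expCode - 1) := pow_le_pow_right₀ (by norm_num) he
  -- `2^(r+2) ∣ n 2^d` (`r + 2 ≤ k + d` is `m_φ + 2 ≤ m_ψ`)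
  have hrk : r + 2 ≤ k + d := by omega
  have hdvd : 2 ^ (r + 2) ∣ n * 2 ^ d := by
    obtain ⟨c, hc⟩ := Nat.exists_eq_add_of_le hrk
    exact ⟨(2 * t + 1) * 2 ^ c, by rw [hn, mul_assoc, ← pow_add, hc, pow_add]; ring⟩
  -- the upper candidate `μ + 2^(r+1)` quanta of `ψ` is a datum `zu`
  set N : ℕ := n * 2 ^ d + 2 ^ (r + 1) with hN
  have hNrep : ψ.Representable N := by
    refine representable_of_pow_dvd (g := r + 1) ?_ ?_ ?_
    · exact dvd_add (dvd_trans (pow_dvd_pow 2 (by omega)) hdvd) dvd_rfl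
    · have h6 : 2 ^ (r + 1) ≤ 2 ^ (k + d) := Nat.pow_le_pow_right (by norm_num) (by omega)
      have h7 : (t + 1) * 2 ^ (k + 1) * 2 ^ d ≤ 2 ^ (ψ.manBits + 1 + (r + 1)) := by
        have h71 : t + 1 ≤ 2 ^ (φ.manBits + 1) := by omega
        calc (t + 1) * 2 ^ (k + 1) * 2 ^ d = (t + 1) * (2 ^ k * 2 ^ d * 2) := by
              rw [pow_succ]; ring
          _ ≤ 2 ^ (φ.manBits + 1) * (2 ^ k * 2 ^ d * 2) := Nat.mul_le_mul_right _ h71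
          _ = 2 ^ (ψ.manBits + 1 + (r + 1)) := by
              rw [show ψ.manBits + 1 + (r + 1) = (ψ.manBits + 1 + r) + 1 by ring,
                pow_succ 2 (ψ.manBits + 1 + r), h5]; ring
      have h8 : (n + 2 ^ k) * 2 ^ d ≤ (t + 1) * 2 ^ (k + 1) * 2 ^ d :=
        Nat.mul_le_mul_right _ hn2
      rw [hN]
      have h9 : n * 2 ^ d + 2 ^ (k + d) = (n + 2 ^ k) * 2 ^ d := by rw [pow_add]; ring
      omega
    · have h8 : (n + 2 ^ k) * 2 ^ d ≤ φ.maxScaled * 2 ^ d :=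
        Nat.mul_le_mul_right _ (le_trans hn2 hu)
      have h6 : 2 ^ (r + 1) ≤ 2 ^ (k + d) := Nat.pow_le_pow_right (by norm_num) (by omega)
      have h9 : n * 2 ^ d + 2 ^ (k + d) = (n + 2 ^ k) * 2 ^ d := by rw [pow_add]; ring
      rw [hN]; omega
  obtain ⟨zu, hzu⟩ := exists_toRat_eq_natMul hNrep
  have hzu' : zu.toRat = (n : ℚ) * φ.quantum + 2 * δ := by
    rw [hzu, hN, hδψ, hquant]; push_cast; ring
  set x := (n : ℚ) * φ.quantum + δ with hx
  -- `fl_ψ x` is `μ` or `μ + 2δ`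
  have hnear := roundNE_nearest (φ := ψ) x zμ
  rw [hzμ, show x - (n : ℚ) * φ.quantum = δ by rw [hx]; ring, abs_of_pos hδ0] at hnear
  have hor : (roundNE ψ x).toRat = zμ.toRat ∨ (roundNE ψ x).toRat = zu.toRat := by
    rcases lt_trichotomy (roundNE ψ x).toRat zμ.toRat with h | h | h
    · exfalso
      rw [hzμ] at h
      rw [abs_of_pos (by rw [hx]; linarith)] at hnear
      rw [hx] at hnear
      linarith
    · exact Or.inl h
    · right
      have h1 := add_ulp_le_of_lt hz0 h
      have h6 : (2 : ℚ) ^ (r + 1) * ψ.quantum ≤ 2 ^ (zμ.expCode - 1) * ψ.quantum :=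
        mul_le_mul_of_nonneg_right hulp hqψ.le
      rw [hzμ] at h1
      have hge : (n : ℚ) * φ.quantum + 2 * δ ≤ (roundNE ψ x).toRat := by linarith
      rcases eq_or_lt_of_le hge with h7 | h7
      · rw [hzu', h7]
      · exfalso
        rw [abs_of_neg (by rw [hx]; linarith)] at hnear
        rw [hx] at hnear
        linarith
  rcases hor with h | h
  · rw [hx] at h; rw [h, hzμ]
  · exfalso
    -- the upper candidate is ODD in `ψ`: an even winner would need `2^(r+2) ∣ N`
    have hev : 2 ∣ (roundNE ψ x).man :=
      roundNE_man_even_of_tie h1ψ (y := zμ)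
        (by rw [h, hzμ, hzu', show x - (n : ℚ) * φ.quantum = δ by rw [hx]; ring,
          show x - ((n : ℚ) * φ.quantum + 2 * δ) = -δ by rw [hx]; ring, abs_neg])
        (by rw [h, hzμ, hzu']; intro heq; linarith)
    rw [two_dvd_man_iff h1ψ] at hev
    have hSu : (roundNE ψ x).scaledMag = N := scaledMag_eq_of_toRat_eq (by rw [h, hzu])
    have heu : r + 1 ≤ (roundNE ψ x).expCode - 1 := by
      apply succ_le_ulpExp_of_le_scaledMag (k := r)
      rw [hSu, hN]; exact le_trans hlow (Nat.le_add_right _ _)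
    rw [hSu] at hev
    obtain ⟨c, hc⟩ := Nat.exists_eq_add_of_le heu
    have h2 : 2 * 2 ^ ((roundNE ψ x).expCode - 1) = 2 ^ (r + 2) * 2 ^ c := by
      rw [hc, show r + 2 = (r + 1) + 1 by ring, pow_succ, pow_add]; ring
    have h3 : 2 ^ (r + 2) ∣ N := dvd_trans (Dvd.intro _ h2.symm) hev
    have h4 : 2 ^ (r + 2) ∣ 2 ^ (r + 1) := by
      have := (Nat.dvd_add_right hdvd).mp (hN ▸ h3)
      exact this
    have h5 := Nat.le_of_dvd (by positivity) h4
    rw [pow_succ] at h5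
    have := Nat.two_pow_pos (r + 1)
    omega

/-- DOUBLE ROUNDING FAILS AT THE TIE OF THE WIDE FORMAT — for every pair of format records with
`m_φ + 2 ≤ m_ψ` (and `P_φ ≥ 2`, `t` even): at `x = μ + δ` with `2δ` equal to the spacing
of `ψ` at `μ`, `fl_φ (fl_ψ x) = t·2^(k+1) ≠ (t+1)·2^(k+1) = fl_φ x` (quanta).
[cite: BoldoMelquiond2008, Thm 3] -/
theorem roundNE_roundNE_ne_gmid_tie {φ ψ : Format} (hq : ψ.qexp ≤ φ.qexp)
    (hM : φ.maxScaled * 2 ^ (φ.qexp - ψ.qexp).toNat ≤ ψ.maxScaled) (h1 : 1 ≤ φ.manBits)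
    (hP2 : φ.manBits + 2 ≤ ψ.manBits) {t k : ℕ} (ht : Even t) (htlo : 2 ^ φ.manBits ≤ t)
    (hthi : t < 2 ^ (φ.manBits + 1)) (hu : (t + 1) * 2 ^ (k + 1) ≤ φ.maxScaled)
    (hk' : ψ.manBits ≤ φ.manBits + k + (φ.qexp - ψ.qexp).toNat) {δ : ℚ}
    (hδψ : 2 * δ
      = 2 ^ (φ.manBits + k + (φ.qexp - ψ.qexp).toNat + 1 - ψ.manBits) * ψ.quantum) :
    (roundNE φ (roundNE ψ ((((2 * t + 1) * 2 ^ k : ℕ) : ℚ) * φ.quantum + δ)).toRat).toRat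
      ≠ (roundNE φ ((((2 * t + 1) * 2 ^ k : ℕ) : ℚ) * φ.quantum + δ)).toRat := by
  have hqφ := φ.quantum_pos
  have hqψ := ψ.quantum_pos
  have hquant : φ.quantum = 2 ^ (φ.qexp - ψ.qexp).toNat * ψ.quantum :=
    quantum_eq_two_pow_mul hq
  have hδ0 : 0 < δ := by
    have : (0 : ℚ) < 2 ^ (φ.manBits + k + (φ.qexp - ψ.qexp).toNat + 1 - ψ.manBits)
        * ψ.quantum := by positivity
    linarith
  -- `δ < 2^k · quantum φ`: here `2δ ≤ 2^(k+d-1) · quantum ψ · 2 ≤ 2^k · quantum φ`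
  have hδ : δ < 2 ^ k * φ.quantum := by
    have h2 : (2 : ℚ) ^ (φ.manBits + k + (φ.qexp - ψ.qexp).toNat + 1 - ψ.manBits) * 2
        ≤ 2 ^ (k + (φ.qexp - ψ.qexp).toNat) := by
      rw [← pow_succ]; exact pow_le_pow_right₀ (by norm_num) (by omega)
    have h3 : (2 : ℚ) ^ (k + (φ.qexp - ψ.qexp).toNat) * ψ.quantum = 2 ^ k * φ.quantum := by
      rw [hquant, pow_add]; ring
    have h4 := mul_le_mul_of_nonneg_right h2 hqψ.le
    rw [h3] at h4
    nlinarith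
  rw [toRat_roundNE_wide_gmid_tie hq hM (by omega) hP2 htlo hthi hu hk' hδψ,
    toRat_roundNE_gmid h1 ht htlo hthi hu, toRat_roundNE_above_gmid htlo hthi hu hδ0 hδ]
  intro h
  have h' := mul_right_cancel₀ hqφ.ne' h
  have h'' : t * 2 ^ (k + 1) = (t + 1) * 2 ^ (k + 1) := by exact_mod_cast h'
  have h3 := Nat.eq_of_mul_eq_mul_right (by positivity) h''
  omega

end Summit.Ventures.CertifiedArithmetic
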